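import Summits.Parity.GeneralizedHardyLittlewood.Theorems.PrimeLevelFamEdgeMomentsBeyondDiagonalDiagBoseMixedRatio
import Summits.Parity.GeneralizedHardyLittlewood.Theorems.PrimeLevelFamEdgeMomentsBeyondDiagonalDiagBoseMixedReduce
import HarnessLib

/-!
# Route `PrimeLevelFamEdge`, crux K_A `MomentsBeyondDiagonal` (stmt-Parity-20007), line «petersson_layers» v4, stub `stub_diag`:
# **census R2, mixed Bose coefficients — the leading term of the ratio integral**

`…DiagBoseMixedRatio.box_eq_ratio_integral` (p819239) writes the unit-box model of the mixed Bose coefficient `c_ab` as the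
one-variable integral `∫_{y<r<1/y}(1+r)^{−2}Φ_{ab}(r,y) dr`,
`Φ_{ab}(r,y) = Σ_{k≤b} C(b,k)(log r)^{b−k}((−max(log r,0))^{a+k+1} − (log(y/r)/2)^{a+k+1})/(a+k+1)`.
Since `log(y/r)/2 = −(L + log r)/2`, `L = log(1/y)`, the only term of degree `a+b+1` in `L` is `k = b`:
pointwise `Φ_{ab}(r,y) = (−1)^{a+b}2^{−(a+b+1)}L^{a+b+1}/(a+b+1) + O((1+L)^{a+b}(1+|log r|)^{a+b+1})`, and
`∫_{y<r<1/y}(1+r)^{−2} = (1−y)/(1+y) = 1 + O(y)`, `yL ≤ 1`, `∫₀^∞(1+|log r|)^{N}(1+r)^{−2} < ∞`: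

* `ratio_integral_leading` — **`|∫_{y<r<1/y}(1+r)^{−2}Φ_{ab}(r,y) dr − (−1)^{a+b}(L/2)^{a+b+1}/(a+b+1)| ≤ C(1+L)^{a+b}`**
  for `0 < y ≤ 1`;
* `bose_coeff_leading` — **CENSUS R2 FOR ALL MIXED COEFFICIENTS: `c_ab(y) = (−1)^{a+b}(log(1/y)/2)^{a+b+1}/(a+b+1)
  + O_{a,b}((1+log(1/y))^{a+b})`, `0 < y ≤ 1`, every `a, b`** (with `…DiagBoseMixedReduce.bose_coeff_sub_box_le` p819297 and
  `…DiagBoseMixedRatio.box_eq_ratio_integral` p819239); the cases `b = 0` / `a = 0` recover p818171 / p818287, and the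
  coefficient `(−1)^{a+b}2^{−(a+b+1)}/(a+b+1)` is the residue predicted by the Mellin factorisation
  `∂ₛ₁^a∂ₛ₂^b[Γ(1+s₁)Γ(1+s₂)ζ(1+s₁+s₂)]` of the diagonal weight (KMV (22)).

Def-free; theorems only. Helper `--supports stmt-Parity-20007`; closes nothing; K_A, K_B and the Parity summit are NOT
proved; nothing about Landau–Siegel zeros.

## References
* E. Kowalski, P. Michel, J. VanderKam, J. reine angew. Math. 526 (2000), (22)–(28) pp. 12–15.
  [cite: KowalskiMichelVanderKam2000, (22)–(28) — derivation (residues of the diagonal weight, real-variable form)]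
-/

noncomputable section

open Real Set MeasureTheory Filter Function Finset

namespace Summit.Parity.GeneralizedHardyLittlewood.Theorems.MomentsBeyondDiagonal.DiagLines

/-- `∫_{y<r<1/y} (1+r)^{−2} dr = (1−y)/(1+y)` for `0 < y ≤ 1`. [folklore] -/
theorem integral_Ioo_inv_one_add_sq {y : ℝ} (hy0 : 0 < y) (hy1 : y ≤ 1) :
    ∫ r in Ioo y y⁻¹, ((1 + r) ^ 2)⁻¹ = (1 - y) / (1 + y) := by
  have hyy : y ≤ y⁻¹ := hy1.trans (one_le_inv_iff₀.2 ⟨hy0, hy1⟩)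
  rw [← integral_Ioc_eq_integral_Ioo, ← intervalIntegral.integral_of_le hyy]
  have hderiv : ∀ r ∈ uIcc y y⁻¹, HasDerivAt (fun r : ℝ ↦ -(1 + r)⁻¹) (((1 + r) ^ 2)⁻¹) r := by
    intro r hr
    rw [uIcc_of_le hyy] at hr
    have hr0 : 0 < 1 + r := by linarith [hr.1]
    have h := ((hasDerivAt_id r).const_add 1).inv hr0.ne'
    have h' := h.neg
    refine h'.congr_deriv ?_
    simp only [id]
    field_simp
  have hcont : ContinuousOn (fun r : ℝ ↦ ((1 + r) ^ 2)⁻¹) (uIcc y y⁻¹) := by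
    rw [uIcc_of_le hyy]
    refine ContinuousOn.inv₀ ((continuousOn_const.add continuousOn_id).pow 2) fun r hr ↦ ?_
    have : 0 < 1 + r := by linarith [hr.1]
    positivity
  rw [intervalIntegral.integral_eq_sub_of_hasDerivAt hderiv hcont.intervalIntegrable]
  have h1 : (1 + y⁻¹) ≠ 0 := by positivity
  have h2 : (1 + y) ≠ 0 := by positivity
  field_simp
  ring

/-- Powers below the top one are dominated: for `0 ≤ x` and `j ≤ N`, `x^j ≤ (1+x)^N`. -/
theorem pow_le_one_add_pow {x : ℝ} (hx : 0 ≤ x) {j N : ℕ} (hj : j ≤ N) : x ^ j ≤ (1 + x) ^ N :=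
  (pow_le_pow_left₀ hx (by linarith) j).trans (pow_le_pow_right₀ (by linarith) hj)

/-- **Pointwise structure of `Φ_{ab}`.** For `r > 0`, `0 < y`, `L = log(1/y) ≥ 0`:
`|Φ_{ab}(r,y) − (−1)^{a+b} 2^{−(a+b+1)} L^{a+b+1}/(a+b+1)| ≤ 3·2^{a+2b+1}(1+L)^{a+b}(1+|log r|)^{a+b+1}`. [folklore] -/
theorem abs_ratioPhi_sub_le {y r : ℝ} (hy : 0 < y) (hL : 0 ≤ Real.log (1 / y)) (hr : 0 < r) (a b : ℕ) :
    |(∑ k ∈ Finset.range (b + 1), (b.choose k : ℝ) * Real.log r ^ (b - k) *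
        ((-(max (Real.log r) 0)) ^ (a + k + 1) - (Real.log (y / r) / 2) ^ (a + k + 1)) / ((a : ℝ) + k + 1)) -
      (-1) ^ (a + b) * (Real.log (1 / y) / 2) ^ (a + b + 1) / ((a : ℝ) + b + 1)| ≤
      3 * 2 ^ (a + 2 * b + 1) * (1 + Real.log (1 / y)) ^ (a + b) * (1 + |Real.log r|) ^ (a + b + 1) := by
  set L : ℝ := Real.log (1 / y) with hLdef
  set ℓ : ℝ := Real.log r with hℓ
  set X : ℝ := 1 + L with hX
  set Z : ℝ := 1 + |ℓ| with hZ
  have hX1 : 1 ≤ X := by rw [hX]; linarith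
  have hZ1 : 1 ≤ Z := by rw [hZ]; linarith [abs_nonneg ℓ]
  have hX0 : 0 ≤ X := by linarith
  have hZ0 : 0 ≤ Z := by linarith
  have hlogyr : Real.log (y / r) = -(L + ℓ) := by
    rw [Real.log_div hy.ne' hr.ne', hLdef, one_div, Real.log_inv]; ring
  -- split the sum into the `max` part `A`, the lower binomial part `B'` (k < b) and the top term (k = b)
  set A : ℕ → ℝ := fun k ↦ (b.choose k : ℝ) * ℓ ^ (b - k) * (-(max ℓ 0)) ^ (a + k + 1) / ((a : ℝ) + k + 1) with hA
  set B : ℕ → ℝ := fun k ↦ (b.choose k : ℝ) * ℓ ^ (b - k) * (-(L + ℓ) / 2) ^ (a + k + 1) / ((a : ℝ) + k + 1) with hB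
  have hsum : (∑ k ∈ Finset.range (b + 1), (b.choose k : ℝ) * ℓ ^ (b - k) *
        ((-(max ℓ 0)) ^ (a + k + 1) - (Real.log (y / r) / 2) ^ (a + k + 1)) / ((a : ℝ) + k + 1)) =
      (∑ k ∈ Finset.range (b + 1), A k) - (∑ k ∈ Finset.range b, B k) - B b := by
    rw [sub_sub, ← Finset.sum_range_succ (fun k ↦ B k) b, ← Finset.sum_sub_distrib]
    refine Finset.sum_congr rfl fun k _ ↦ ?_
    rw [hA, hB, hlogyr]
    ring
  -- the top term minus the main term
  have hN1 : ((a : ℝ) + b + 1) ≠ 0 := by positivity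
  have htop : B b - (-((-1) ^ (a + b) * (L / 2) ^ (a + b + 1) / ((a : ℝ) + b + 1))) =
      (-1) ^ (a + b + 1) / 2 ^ (a + b + 1) / ((a : ℝ) + b + 1) *
        ∑ j ∈ Finset.range (a + b + 1), L ^ j * ℓ ^ (a + b + 1 - j) * ((a + b + 1).choose j : ℝ) := by
    have hexp : (L + ℓ) ^ (a + b + 1) = (∑ j ∈ Finset.range (a + b + 1), L ^ j * ℓ ^ (a + b + 1 - j) *
        ((a + b + 1).choose j : ℝ)) + L ^ (a + b + 1) := by
      rw [add_pow, Finset.sum_range_succ, Nat.sub_self, pow_zero, mul_one, Nat.choose_self, Nat.cast_one, mul_one]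
    have e1 : (-(L + ℓ) / 2) ^ (a + b + 1) = -(-1) ^ (a + b) * (L + ℓ) ^ (a + b + 1) / 2 ^ (a + b + 1) := by
      rw [neg_div, neg_pow, div_pow, pow_succ]; ring
    have e2 : (L / 2) ^ (a + b + 1) = L ^ (a + b + 1) / 2 ^ (a + b + 1) := div_pow _ _ _
    have h2 : (2 : ℝ) ^ (a + b + 1) ≠ 0 := by positivity
    rw [hB]
    simp only [Nat.choose_self, Nat.cast_one, one_mul, Nat.sub_self, pow_zero]
    rw [e1, e2, hexp]
    field_simp
    ring
  -- bounds for the three parts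
  have hℓmax : |-(max ℓ 0)| ≤ |ℓ| := by
    rw [abs_neg]
    rcases le_or_gt ℓ 0 with h | h
    · rw [max_eq_right h, abs_zero]; exact abs_nonneg _
    · rw [max_eq_left h.le]
  have hchoose_sum : ∀ n : ℕ, ∑ k ∈ Finset.range (n + 1), (n.choose k : ℝ) = 2 ^ n := by
    intro n
    have h := (add_pow (1 : ℝ) 1 n).symm
    simp only [one_pow, one_mul, mul_one] at h
    rw [h]; norm_num
  have hAbd : |∑ k ∈ Finset.range (b + 1), A k| ≤ 2 ^ b * Z ^ (a + b + 1) := by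
    calc |∑ k ∈ Finset.range (b + 1), A k| ≤ ∑ k ∈ Finset.range (b + 1), |A k| := Finset.abs_sum_le_sum_abs _ _
      _ ≤ ∑ k ∈ Finset.range (b + 1), (b.choose k : ℝ) * Z ^ (a + b + 1) := by
          refine Finset.sum_le_sum fun k hk ↦ ?_
          have hkb : k ≤ b := Nat.lt_succ_iff.1 (Finset.mem_range.1 hk)
          rw [hA]
          simp only
          rw [abs_div, abs_mul, abs_mul, abs_pow, abs_pow, Nat.abs_cast,
            abs_of_pos (by positivity : (0 : ℝ) < (a : ℝ) + k + 1)]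
          have h1 : |ℓ| ^ (b - k) * |-(max ℓ 0)| ^ (a + k + 1) ≤ Z ^ (a + b + 1) := by
            calc |ℓ| ^ (b - k) * |-(max ℓ 0)| ^ (a + k + 1) ≤ |ℓ| ^ (b - k) * |ℓ| ^ (a + k + 1) := by gcongr
              _ = |ℓ| ^ (a + b + 1) := by rw [← pow_add]; congr 1; omega
              _ ≤ Z ^ (a + b + 1) := pow_le_pow_left₀ (abs_nonneg _) (by rw [hZ]; linarith) _
          have hden : (1 : ℝ) ≤ (a : ℝ) + k + 1 := by linarith [(Nat.cast_nonneg k : (0 : ℝ) ≤ k), (Nat.cast_nonneg a : (0 : ℝ) ≤ a)]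
          calc (b.choose k : ℝ) * |ℓ| ^ (b - k) * |-(max ℓ 0)| ^ (a + k + 1) / ((a : ℝ) + k + 1)
              ≤ (b.choose k : ℝ) * |ℓ| ^ (b - k) * |-(max ℓ 0)| ^ (a + k + 1) := div_le_self (by positivity) hden
            _ = (b.choose k : ℝ) * (|ℓ| ^ (b - k) * |-(max ℓ 0)| ^ (a + k + 1)) := by ring
            _ ≤ (b.choose k : ℝ) * Z ^ (a + b + 1) := by gcongr
      _ = 2 ^ b * Z ^ (a + b + 1) := by rw [← Finset.sum_mul, hchoose_sum]
  have hBbd : |∑ k ∈ Finset.range b, B k| ≤ 2 ^ b * X ^ (a + b) * Z ^ (a + b + 1) := by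
    have hLℓ : |-(L + ℓ) / 2| ≤ X * Z := by
      rw [abs_div, abs_neg, abs_two]
      calc |L + ℓ| / 2 ≤ |L + ℓ| := by linarith [abs_nonneg (L + ℓ)]
        _ ≤ |L| + |ℓ| := abs_add_le _ _
        _ = L + |ℓ| := by rw [abs_of_nonneg hL]
        _ ≤ X * Z := by rw [hX, hZ]; nlinarith [abs_nonneg ℓ]
    calc |∑ k ∈ Finset.range b, B k| ≤ ∑ k ∈ Finset.range b, |B k| := Finset.abs_sum_le_sum_abs _ _
      _ ≤ ∑ k ∈ Finset.range b, (b.choose k : ℝ) * (X ^ (a + b) * Z ^ (a + b + 1)) := by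
          refine Finset.sum_le_sum fun k hk ↦ ?_
          have hkb : k < b := Finset.mem_range.1 hk
          rw [hB]
          simp only
          rw [abs_div, abs_mul, abs_mul, abs_pow, abs_pow, Nat.abs_cast,
            abs_of_pos (by positivity : (0 : ℝ) < (a : ℝ) + k + 1)]
          have hden : (1 : ℝ) ≤ (a : ℝ) + k + 1 := by linarith [(Nat.cast_nonneg k : (0 : ℝ) ≤ k), (Nat.cast_nonneg a : (0 : ℝ) ≤ a)]
          have h1 : |ℓ| ^ (b - k) * |-(L + ℓ) / 2| ^ (a + k + 1) ≤ X ^ (a + b) * Z ^ (a + b + 1) := by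
            calc |ℓ| ^ (b - k) * |-(L + ℓ) / 2| ^ (a + k + 1) ≤ Z ^ (b - k) * (X * Z) ^ (a + k + 1) := by
                  gcongr
                  rw [hZ]; linarith [abs_nonneg ℓ]
              _ = X ^ (a + k + 1) * Z ^ (a + b + 1) := by
                  rw [mul_pow, mul_comm, mul_assoc, ← pow_add]; congr 2; omega
              _ ≤ X ^ (a + b) * Z ^ (a + b + 1) :=
                  mul_le_mul_of_nonneg_right (pow_le_pow_right₀ hX1 (by omega)) (by positivity)
          calc (b.choose k : ℝ) * |ℓ| ^ (b - k) * |-(L + ℓ) / 2| ^ (a + k + 1) / ((a : ℝ) + k + 1)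
              ≤ (b.choose k : ℝ) * |ℓ| ^ (b - k) * |-(L + ℓ) / 2| ^ (a + k + 1) := div_le_self (by positivity) hden
            _ = (b.choose k : ℝ) * (|ℓ| ^ (b - k) * |-(L + ℓ) / 2| ^ (a + k + 1)) := by ring
            _ ≤ (b.choose k : ℝ) * (X ^ (a + b) * Z ^ (a + b + 1)) := by gcongr
      _ ≤ ∑ k ∈ Finset.range (b + 1), (b.choose k : ℝ) * (X ^ (a + b) * Z ^ (a + b + 1)) := by
          refine Finset.sum_le_sum_of_subset_of_nonneg (Finset.range_mono (Nat.le_succ b)) fun k _ _ ↦ ?_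
          positivity
      _ = 2 ^ b * X ^ (a + b) * Z ^ (a + b + 1) := by rw [← Finset.sum_mul, hchoose_sum]; ring
  have hTbd : |B b - (-((-1) ^ (a + b) * (L / 2) ^ (a + b + 1) / ((a : ℝ) + b + 1)))| ≤
      2 ^ (a + b + 1) * X ^ (a + b) * Z ^ (a + b + 1) := by
    rw [htop, abs_mul]
    have hc : |(-1 : ℝ) ^ (a + b + 1) / 2 ^ (a + b + 1) / ((a : ℝ) + b + 1)| ≤ 1 := by
      rw [abs_div, abs_div, abs_pow, abs_neg, abs_one, one_pow, abs_of_pos (by positivity : (0 : ℝ) < 2 ^ (a + b + 1)),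
        abs_of_pos (by positivity : (0 : ℝ) < (a : ℝ) + b + 1)]
      have h2 : (1 : ℝ) ≤ 2 ^ (a + b + 1) := one_le_pow₀ (by norm_num)
      have h3 : (1 : ℝ) ≤ (a : ℝ) + b + 1 := by linarith [(Nat.cast_nonneg a : (0 : ℝ) ≤ a), (Nat.cast_nonneg b : (0 : ℝ) ≤ b)]
      calc (1 : ℝ) / 2 ^ (a + b + 1) / ((a : ℝ) + b + 1) ≤ 1 / 2 ^ (a + b + 1) := div_le_self (by positivity) h3
        _ ≤ 1 := by rw [div_le_one (by positivity)]; exact h2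
    have hs : |∑ j ∈ Finset.range (a + b + 1), L ^ j * ℓ ^ (a + b + 1 - j) * ((a + b + 1).choose j : ℝ)| ≤
        2 ^ (a + b + 1) * X ^ (a + b) * Z ^ (a + b + 1) := by
      calc |∑ j ∈ Finset.range (a + b + 1), L ^ j * ℓ ^ (a + b + 1 - j) * ((a + b + 1).choose j : ℝ)|
          ≤ ∑ j ∈ Finset.range (a + b + 1), |L ^ j * ℓ ^ (a + b + 1 - j) * ((a + b + 1).choose j : ℝ)| :=
            Finset.abs_sum_le_sum_abs _ _
        _ ≤ ∑ j ∈ Finset.range (a + b + 1), ((a + b + 1).choose j : ℝ) * (X ^ (a + b) * Z ^ (a + b + 1)) := by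
            refine Finset.sum_le_sum fun j hj ↦ ?_
            have hjN : j ≤ a + b := Nat.lt_succ_iff.1 (Finset.mem_range.1 hj)
            rw [abs_mul, abs_mul, abs_pow, abs_pow, Nat.abs_cast, abs_of_nonneg hL]
            have h1 : L ^ j ≤ X ^ (a + b) := pow_le_one_add_pow hL hjN
            have h2 : |ℓ| ^ (a + b + 1 - j) ≤ Z ^ (a + b + 1) := pow_le_one_add_pow (abs_nonneg _) (by omega)
            calc L ^ j * |ℓ| ^ (a + b + 1 - j) * ((a + b + 1).choose j : ℝ)
                = ((a + b + 1).choose j : ℝ) * (L ^ j * |ℓ| ^ (a + b + 1 - j)) := by ring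
              _ ≤ ((a + b + 1).choose j : ℝ) * (X ^ (a + b) * Z ^ (a + b + 1)) := by gcongr
        _ ≤ ∑ j ∈ Finset.range (a + b + 1 + 1), ((a + b + 1).choose j : ℝ) * (X ^ (a + b) * Z ^ (a + b + 1)) := by
            refine Finset.sum_le_sum_of_subset_of_nonneg (Finset.range_mono (Nat.le_succ _)) fun k _ _ ↦ ?_
            positivity
        _ = 2 ^ (a + b + 1) * X ^ (a + b) * Z ^ (a + b + 1) := by rw [← Finset.sum_mul, hchoose_sum]; ring
    calc |(-1 : ℝ) ^ (a + b + 1) / 2 ^ (a + b + 1) / ((a : ℝ) + b + 1)| *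
          |∑ j ∈ Finset.range (a + b + 1), L ^ j * ℓ ^ (a + b + 1 - j) * ((a + b + 1).choose j : ℝ)|
        ≤ 1 * (2 ^ (a + b + 1) * X ^ (a + b) * Z ^ (a + b + 1)) := by gcongr
      _ = _ := one_mul _
  -- assemble
  rw [hsum]
  have hXZ : Z ^ (a + b + 1) ≤ X ^ (a + b) * Z ^ (a + b + 1) :=
    le_mul_of_one_le_left (by positivity) (one_le_pow₀ hX1)
  have h2b : (2 : ℝ) ^ b ≤ 2 ^ (a + 2 * b + 1) := pow_le_pow_right₀ (by norm_num) (by omega)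
  have h2ab : (2 : ℝ) ^ (a + b + 1) ≤ 2 ^ (a + 2 * b + 1) := pow_le_pow_right₀ (by norm_num) (by omega)
  have hP0 : 0 ≤ X ^ (a + b) * Z ^ (a + b + 1) := by positivity
  calc |(∑ k ∈ Finset.range (b + 1), A k) - (∑ k ∈ Finset.range b, B k) - B b -
        (-1) ^ (a + b) * (L / 2) ^ (a + b + 1) / ((a : ℝ) + b + 1)|
      = |(∑ k ∈ Finset.range (b + 1), A k) + (-(∑ k ∈ Finset.range b, B k)) +
          (-(B b - (-((-1) ^ (a + b) * (L / 2) ^ (a + b + 1) / ((a : ℝ) + b + 1)))))| := by ring_nf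
    _ ≤ |∑ k ∈ Finset.range (b + 1), A k| + |(-(∑ k ∈ Finset.range b, B k))| +
          |(-(B b - (-((-1) ^ (a + b) * (L / 2) ^ (a + b + 1) / ((a : ℝ) + b + 1)))))| := abs_add_three _ _ _
    _ ≤ 2 ^ b * Z ^ (a + b + 1) + 2 ^ b * X ^ (a + b) * Z ^ (a + b + 1) +
          2 ^ (a + b + 1) * X ^ (a + b) * Z ^ (a + b + 1) := by
        rw [abs_neg, abs_neg]; exact add_le_add_three hAbd hBbd hTbd
    _ ≤ 2 ^ (a + 2 * b + 1) * (X ^ (a + b) * Z ^ (a + b + 1)) + 2 ^ (a + 2 * b + 1) * (X ^ (a + b) * Z ^ (a + b + 1)) +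
          2 ^ (a + 2 * b + 1) * (X ^ (a + b) * Z ^ (a + b + 1)) := by
        refine add_le_add_three ?_ ?_ ?_
        · calc (2 : ℝ) ^ b * Z ^ (a + b + 1) ≤ 2 ^ b * (X ^ (a + b) * Z ^ (a + b + 1)) := by gcongr
            _ ≤ _ := by gcongr
        · rw [mul_assoc]; gcongr
        · rw [mul_assoc]; gcongr
    _ = 3 * 2 ^ (a + 2 * b + 1) * X ^ (a + b) * Z ^ (a + b + 1) := by ring

/-- Measurability of `r ↦ Φ_{ab}(r,y)`. -/
theorem measurable_ratioPhi (y : ℝ) (a b : ℕ) :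
    Measurable fun r : ℝ ↦ ∑ k ∈ Finset.range (b + 1), (b.choose k : ℝ) * Real.log r ^ (b - k) *
        ((-(max (Real.log r) 0)) ^ (a + k + 1) - (Real.log (y / r) / 2) ^ (a + k + 1)) / ((a : ℝ) + k + 1) := by
  refine Finset.measurable_sum _ fun k _ ↦ ?_
  refine Measurable.div (Measurable.mul (measurable_const.mul (Real.measurable_log.pow_const _)) ?_) measurable_const
  refine Measurable.sub ((Real.measurable_log.max measurable_const).neg.pow_const _) ?_
  exact ((Real.measurable_log.comp (measurable_const.div measurable_id)).div measurable_const).pow_const _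

/-- **THE LEADING TERM OF THE RATIO INTEGRAL.** For all `a, b` there is `C` such that for `0 < y ≤ 1`, `L = log(1/y)`:
`|∫_{y<r<1/y}(1+r)^{−2}Φ_{ab}(r,y) dr − (−1)^{a+b}(L/2)^{a+b+1}/(a+b+1)| ≤ C(1+L)^{a+b}`.
[cite: KowalskiMichelVanderKam2000, (22)–(28) — derivation (leading residue of the diagonal weight, mixed coefficient)] -/
theorem ratio_integral_leading (a b : ℕ) : ∃ C : ℝ, ∀ y : ℝ, 0 < y → y ≤ 1 →
    |(∫ r in Ioo y y⁻¹, (∑ k ∈ Finset.range (b + 1), (b.choose k : ℝ) * Real.log r ^ (b - k) *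
          ((-(max (Real.log r) 0)) ^ (a + k + 1) - (Real.log (y / r) / 2) ^ (a + k + 1)) / ((a : ℝ) + k + 1)) /
          (1 + r) ^ 2) -
        (-1) ^ (a + b) * (Real.log (1 / y) / 2) ^ (a + b + 1) / ((a : ℝ) + b + 1)| ≤
      C * (1 + Real.log (1 / y)) ^ (a + b) := by
  set K : ℝ := 3 * 2 ^ (a + 2 * b + 1) with hK
  have hJint := integrableOn_one_add_abs_log_pow_div_sq (a + b + 1)
  set J : ℝ := ∫ r in Ioi (0 : ℝ), (1 + |Real.log r|) ^ (a + b + 1) / (1 + r) ^ 2 with hJ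
  have hJ0 : 0 ≤ J := setIntegral_nonneg measurableSet_Ioi fun r (hr : 0 < r) ↦ by positivity
  refine ⟨K * J + 2, fun y hy0 hy1 ↦ ?_⟩
  set L : ℝ := Real.log (1 / y) with hL
  have hL0 : 0 ≤ L := by rw [hL, one_div, Real.log_inv]; have := Real.log_nonpos hy0.le hy1; linarith
  have hyL : y * L ≤ 1 := by
    have h := Real.log_le_sub_one_of_pos (by positivity : (0 : ℝ) < 1 / y)
    have : y * L ≤ y * (1 / y - 1) := mul_le_mul_of_nonneg_left h hy0.le
    rw [mul_sub, mul_one_div_cancel hy0.ne'] at this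
    linarith
  set X : ℝ := 1 + L with hX
  have hX1 : 1 ≤ X := by rw [hX]; linarith
  set T : ℝ := (-1) ^ (a + b) * (L / 2) ^ (a + b + 1) / ((a : ℝ) + b + 1) with hT
  set Φ : ℝ → ℝ := fun r ↦ ∑ k ∈ Finset.range (b + 1), (b.choose k : ℝ) * Real.log r ^ (b - k) *
      ((-(max (Real.log r) 0)) ^ (a + k + 1) - (Real.log (y / r) / 2) ^ (a + k + 1)) / ((a : ℝ) + k + 1) with hΦ
  have hΦmeas : Measurable Φ := measurable_ratioPhi y a b
  have hsub : Ioo y y⁻¹ ⊆ Ioi 0 := fun r hr ↦ hy0.trans hr.1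
  -- pointwise bound on `(y, 1/y)`
  have hptw : ∀ r ∈ Ioo y y⁻¹, |Φ r - T| ≤ K * X ^ (a + b) * (1 + |Real.log r|) ^ (a + b + 1) := by
    intro r hr
    have h := abs_ratioPhi_sub_le hy0 hL0 (hy0.trans hr.1) a b
    rw [hΦ, hT, hK, hX]
    exact h
  -- integrability on `(y, 1/y)`
  have hD_int : IntegrableOn (fun r : ℝ ↦ K * X ^ (a + b) * ((1 + |Real.log r|) ^ (a + b + 1) / (1 + r) ^ 2))
      (Ioo y y⁻¹) := (hJint.mono_set hsub).const_mul _
  have hg₀_int : IntegrableOn (fun r : ℝ ↦ ((1 + r) ^ 2)⁻¹) (Ioo y y⁻¹) := by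
    have h0 := (integrableOn_one_add_abs_log_pow_div_sq 0).mono_set hsub
    refine h0.congr_fun (fun r _ ↦ ?_) measurableSet_Ioo
    show (1 + |Real.log r|) ^ 0 / (1 + r) ^ 2 = ((1 + r) ^ 2)⁻¹
    rw [pow_zero, one_div]
  have hE_int : IntegrableOn (fun r : ℝ ↦ (Φ r - T) / (1 + r) ^ 2) (Ioo y y⁻¹) := by
    refine Integrable.mono' hD_int ?_ ?_
    · exact ((hΦmeas.sub measurable_const).div ((measurable_const.add measurable_id).pow_const 2)).aestronglyMeasurable
    · rw [ae_restrict_iff' measurableSet_Ioo]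
      refine ae_of_all _ fun r hr ↦ ?_
      have hr0 : 0 < r := hy0.trans hr.1
      rw [norm_div, Real.norm_eq_abs, Real.norm_eq_abs, abs_of_pos (by positivity : (0 : ℝ) < (1 + r) ^ 2),
        ← mul_div_assoc]
      exact div_le_div_of_nonneg_right (hptw r hr) (by positivity)
  have hΦ_int : IntegrableOn (fun r : ℝ ↦ Φ r / (1 + r) ^ 2) (Ioo y y⁻¹) := by
    refine ((hE_int.add (hg₀_int.const_mul T))).congr_fun (fun r hr ↦ ?_) measurableSet_Ioo
    have hr0 : 0 < r := hy0.trans hr.1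
    have : (1 + r) ^ 2 ≠ 0 := by positivity
    show (Φ r - T) / (1 + r) ^ 2 + T * ((1 + r) ^ 2)⁻¹ = Φ r / (1 + r) ^ 2
    field_simp
    ring
  -- split the integral
  have hsplit : ∫ r in Ioo y y⁻¹, Φ r / (1 + r) ^ 2 =
      (∫ r in Ioo y y⁻¹, (Φ r - T) / (1 + r) ^ 2) + T * ∫ r in Ioo y y⁻¹, ((1 + r) ^ 2)⁻¹ := by
    rw [← integral_const_mul, ← integral_add hE_int (hg₀_int.const_mul T)]
    refine setIntegral_congr_fun measurableSet_Ioo fun r hr ↦ ?_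
    have hr0 : 0 < r := hy0.trans hr.1
    have : (1 + r) ^ 2 ≠ 0 := by positivity
    field_simp
    ring
  have hgoal : (∫ r in Ioo y y⁻¹, (∑ k ∈ Finset.range (b + 1), (b.choose k : ℝ) * Real.log r ^ (b - k) *
          ((-(max (Real.log r) 0)) ^ (a + k + 1) - (Real.log (y / r) / 2) ^ (a + k + 1)) / ((a : ℝ) + k + 1)) /
          (1 + r) ^ 2) = ∫ r in Ioo y y⁻¹, Φ r / (1 + r) ^ 2 := by simp only [hΦ]
  rw [hgoal, hsplit, integral_Ioo_inv_one_add_sq hy0 hy1]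
  -- the error integral
  have hE : |∫ r in Ioo y y⁻¹, (Φ r - T) / (1 + r) ^ 2| ≤ K * X ^ (a + b) * J := by
    have h1 : ‖∫ r in Ioo y y⁻¹, (Φ r - T) / (1 + r) ^ 2‖ ≤
        ∫ r in Ioo y y⁻¹, K * X ^ (a + b) * ((1 + |Real.log r|) ^ (a + b + 1) / (1 + r) ^ 2) := by
      refine norm_integral_le_of_norm_le hD_int ?_
      rw [ae_restrict_iff' measurableSet_Ioo]
      refine ae_of_all _ fun r hr ↦ ?_
      have hr0 : 0 < r := hy0.trans hr.1
      rw [norm_div, Real.norm_eq_abs, Real.norm_eq_abs, abs_of_pos (by positivity : (0 : ℝ) < (1 + r) ^ 2),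
        ← mul_div_assoc]
      exact div_le_div_of_nonneg_right (hptw r hr) (by positivity)
    rw [Real.norm_eq_abs, integral_const_mul] at h1
    refine h1.trans (mul_le_mul_of_nonneg_left ?_ (by positivity))
    exact setIntegral_mono_set hJint (ae_of_all _ fun r ↦ by positivity) (ae_of_all _ hsub)
  -- the truncation of the main term
  have hTabs : |T| ≤ L ^ (a + b + 1) := by
    rw [hT, abs_div, abs_mul, abs_pow, abs_pow, abs_neg, abs_one, one_pow, one_mul,
      abs_of_nonneg (by positivity : (0 : ℝ) ≤ L / 2), abs_of_pos (by positivity : (0 : ℝ) < (a : ℝ) + b + 1)]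
    have h3 : (1 : ℝ) ≤ (a : ℝ) + b + 1 := by
      linarith [(Nat.cast_nonneg a : (0 : ℝ) ≤ a), (Nat.cast_nonneg b : (0 : ℝ) ≤ b)]
    calc (L / 2) ^ (a + b + 1) / ((a : ℝ) + b + 1) ≤ (L / 2) ^ (a + b + 1) := div_le_self (by positivity) h3
      _ ≤ L ^ (a + b + 1) := pow_le_pow_left₀ (by positivity) (by linarith) _
  have hM : |T * ((1 - y) / (1 + y)) - T| ≤ 2 * X ^ (a + b) := by
    have hy1' : 0 < 1 + y := by linarith
    have hfrac_eq : (1 - y) / (1 + y) - 1 = -(2 * y / (1 + y)) := by field_simp; ring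
    have h2y : 0 ≤ 2 * y / (1 + y) := div_nonneg (by linarith) hy1'.le
    have heq : |T * ((1 - y) / (1 + y)) - T| = |T| * (2 * y / (1 + y)) := by
      calc |T * ((1 - y) / (1 + y)) - T| = |T * ((1 - y) / (1 + y) - 1)| := by congr 1; ring
        _ = |T| * |(1 - y) / (1 + y) - 1| := abs_mul _ _
        _ = |T| * (2 * y / (1 + y)) := by rw [hfrac_eq, abs_neg, abs_of_nonneg h2y]
    rw [heq]
    have hfrac : 2 * y / (1 + y) ≤ 2 * y := div_le_self (by positivity) (by linarith)
    calc |T| * (2 * y / (1 + y)) ≤ L ^ (a + b + 1) * (2 * y) := by gcongr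
      _ = 2 * (y * L) * L ^ (a + b) := by ring
      _ ≤ 2 * 1 * X ^ (a + b) := by
          gcongr
          · rw [hX]; linarith
      _ = 2 * X ^ (a + b) := by ring
  calc |(∫ r in Ioo y y⁻¹, (Φ r - T) / (1 + r) ^ 2) + T * ((1 - y) / (1 + y)) - T|
      = |(∫ r in Ioo y y⁻¹, (Φ r - T) / (1 + r) ^ 2) + (T * ((1 - y) / (1 + y)) - T)| := by rw [add_sub_assoc]
    _ ≤ |∫ r in Ioo y y⁻¹, (Φ r - T) / (1 + r) ^ 2| + |T * ((1 - y) / (1 + y)) - T| := abs_add_le _ _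
    _ ≤ K * X ^ (a + b) * J + 2 * X ^ (a + b) := add_le_add hE hM
    _ = (K * J + 2) * X ^ (a + b) := by ring

/-- **THE LEADING SMALL-`y` TERM OF EVERY MIXED BOSE COEFFICIENT (census R2).** For all `a, b` there is `C` such that for
`0 < y ≤ 1`:
`|∫_{u₁>0}(log u₁)^a∫_{u₂>y/u₁} e^{−(u₁+u₂)}(1−e^{−(u₁+u₂)})^{−2}(log u₂)^b − (−1)^{a+b}(log(1/y)/2)^{a+b+1}/(a+b+1)|
   ≤ C(1+log(1/y))^{a+b}`.
[cite: KowalskiMichelVanderKam2000, (22)–(28) — derivation (leading residue of the diagonal weight, mixed coefficient c_ab)] -/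
theorem bose_coeff_leading (a b : ℕ) : ∃ C : ℝ, ∀ y : ℝ, 0 < y → y ≤ 1 →
    |(∫ u₁ in Ioi (0 : ℝ), Real.log u₁ ^ a *
        ∫ u₂ in Ioi (y / u₁), Real.exp (-(u₁ + u₂)) / (1 - Real.exp (-(u₁ + u₂))) ^ 2 * Real.log u₂ ^ b) -
        (-1) ^ (a + b) * (Real.log (1 / y) / 2) ^ (a + b + 1) / ((a : ℝ) + b + 1)| ≤
      C * (1 + Real.log (1 / y)) ^ (a + b) := by
  obtain ⟨C₁, hC₁⟩ := bose_coeff_sub_box_le a b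
  obtain ⟨C₂, hC₂⟩ := ratio_integral_leading a b
  have hC₁0 : 0 ≤ C₁ := (abs_nonneg _).trans (hC₁ 1 one_pos)
  refine ⟨C₁ + C₂, fun y hy0 hy1 ↦ ?_⟩
  have h1 := hC₁ y hy0
  have h2 := hC₂ y hy0 hy1
  rw [box_eq_ratio_integral hy0 a b] at h1
  have hL0 : 0 ≤ Real.log (1 / y) := by
    rw [one_div, Real.log_inv]; have := Real.log_nonpos hy0.le hy1; linarith
  have hX1 : 1 ≤ (1 + Real.log (1 / y)) ^ (a + b) := one_le_pow₀ (by linarith)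
  calc _ ≤ C₁ + C₂ * (1 + Real.log (1 / y)) ^ (a + b) := by
        refine (abs_sub_le _ _ _).trans (add_le_add h1 h2)
    _ ≤ C₁ * (1 + Real.log (1 / y)) ^ (a + b) + C₂ * (1 + Real.log (1 / y)) ^ (a + b) := by
        gcongr; exact le_mul_of_one_le_right hC₁0 hX1
    _ = (C₁ + C₂) * (1 + Real.log (1 / y)) ^ (a + b) := by ring

end Summit.Parity.GeneralizedHardyLittlewood.Theorems.MomentsBeyondDiagonal.DiagLines

end
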